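import Summits.BirchSwinnertonDyer.BirchSwinnertonDyer.Theorems.PrintCf2SplitBadEisensteinTwoFinLocOfCMLines
import HarnessLib

/-!
# `stub_finLoc_two` from the ORDINARY FILTRATION at `2` (one stable line, unit-root quotient character):
# the CM-free form of the cite-level residual of crux 20368's local finiteness stub

Cell `bsd-print-cf2`, seat `bsd-line-cf2-p1-w2` g5 (prover, width seat on crux stmt-BirchSwinnertonDyer-20368
`PrintCf2.SplitBadTwoRankOneOfFacts`; line `eisenstein_two_bdp_line` v9.1, skeleton 4c61375c77ad), registered stub
**`stub_finLoc_two`** (`… → SchneiderFreeControlAtoms.LocalTowerTorsionFiniteAt (W.baseChange K) 2 κ 𝔭`). Sequel of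
`PrintCf2SplitBadEisensteinTwoFinLocOfCMLines` (p632925: the stub from the TWO CM eigen-lines with their characters).
`--supports stmt-BirchSwinnertonDyer-20368` (helper). THEOREMS ONLY (0 definitions, 0 named facts, 0 `sorry`); closes nothing
by itself; BSD is not advanced by any of this; no summit statement is proved by this seat.

WHY A SECOND FORM. The class (`49a·^{(d)}`, `j ∈ {−3375, 16581375}`) is a quadratic twist `E₀ ⊗ χ` of a conductor-`49` curve
`E₀`, which has GOOD ORDINARY reduction at `2` (`a₂(E₀) = ±1`). The local structure the stub needs is therefore already carried by
Greenberg's ORDINARY FILTRATION — ONE `D_𝔭`-stable line `C ≤ E[2^∞]` (the `2^∞`-torsion of the kernel of reduction) with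
`E[2^∞]/C ≅ Ẽ₀[2^∞] ≅ ℚ₂/ℤ₂`, on which an element of Frobenius degree `n` acts by `χ(σ)·α^n` (`α` the unit root of
`X² − a₂X + 2`, i.e. of `X² − X + 2` up to sign: the `2`-power Frobenius `φ` of `Ẽ₀` satisfies `φ² − a₂φ + 2 = 0` on points and acts
on the cyclic group `Ẽ₀[2^k]` by the ODD root of that congruence), and on `C` by `ε·(that)⁻¹` (`det = ε`) — with NO complex
multiplication input. Every brick of that description except the unit-root Frobenius eigenvalue is a tree theorem
(`ellipticOrdinaryReduction_tateModule_filtration_holds`, Greenberg 1991 §2, at the level of `V_p` with the inertia characters;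
`geomReduction_smul_of_isArithFrobAt`; `frobenius_frobenius_sub_trace_smul_add_card_smul`; `OrdinaryReductionKernelTorsionProofs` §5);
this file states the integral, Frobenius-level datum as ONE displayed hypothesis and proves the stub from it, through the
FILTRATION form of the fixed-point principle (`WeierstrassCurve.localTowerTorsionFiniteAt_of_stableLine_quotient`, p628031).

* §1 `pow_smul_mem_of_pow_smul_zsmul_mem`, `boundedKernel_mod_of_smul_congr_padicInt` — Bézout and the graded bounded-kernel
  clause MODULO a subgroup `C` (the quotient mover), twins of `LocalTowerTorsionTwoLines.pow_smul_eq_zero_of_pow_smul_zsmul_eq_zero`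
  and `EisensteinTwo.boundedKernel_of_smul_congr_padicInt`.
* §2 `exists_normResidue_scalars_ne_one` — the MOVER packaged once: at a degree-one `𝔭 ∣ 2` of an imaginary quadratic `K` there
  is `σ₀ ∈ Γ_{K_𝔭}` of Frobenius degree `h ≥ 1` with `res σ₀ ∈ ker κ` for every anticyclotomic `κ` (p627732) such that, for every
  unit `α ∈ ℤ₂` with `α² = α − 2` and every sign `s`, `s·α^h ≠ 1` (`unitRoot_pow_ne_of_sq_eq`) and `s·ε(res σ₀)·α^{−h} ≠ 1`
  (`ε(σ₀)φ(π)² = 2^{2h}` + the weight obstruction `ne_of_unitRoot_of_span_eq_pow`).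
* §3 **`finLoc_two_of_ordinaryFiltration_at`** — ONE frame `(W, K, κ, 𝔭)`: from a subgroup `C ≤ E[2^∞]` (`E = W.baseChange K`),
  `α ∈ ℤ₂ˣ` with `α² = α − 2`, and for every `σ ∈ Γ_{K_𝔭}` of Frobenius degree `n` signs `s₁, s₂` with: `res σ` acts on
  `E[2^∞]/C` as any `N ≡ s₂·α^n (mod 2^k)` on the classes killed by `2^k` (`2^k x ∈ C ⟹ res σ·x − N·x ∈ C`) and on each `c ∈ C`
  killed by `2^k` as any `N ≡ s₁·ε(res σ)·α^{−n}` — conclude `LocalTowerTorsionFiniteAt E 2 κ 𝔭`.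
* §4 **`finLoc_two_of_ordinaryFiltration`** — the registered signature of `stub_finLoc_two` VERBATIM as conclusion from the ∀-form
  `hFilt` of the §3 datum over the class; the alternative cite-level stub text for the lead
  (`stub_ordinaryFiltrationAtTwo`, Greenberg 1991 §2 + Mazur 1972 / Serre 1972 §1.11 read at `p = 2` on the good twist, transported
  to `W` by the quadratic twist), with `stub_finLoc_two := finLoc_two_of_ordinaryFiltration stub_ordinaryFiltrationAtTwo`.

References: [Greenberg1991] §2 (p. 214); [GreenbergLNM1716] §2 pp. 62–63, §3 Lemma 3.3; [SerreInventiones1972] §1.11 Prop. 11;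
[JetchevSkinnerWan2017] §3.3 Prop. 3.3.4 Case 3(b); [CasselsFrohlichANT1967] Ch. VII §6; [Brink2007] §II Prop. 1.
-/

noncomputable section

open scoped Classical

namespace Summit.BirchSwinnertonDyer.BirchSwinnertonDyer.Theorems.PrintCf2.EisensteinTwo

open NumberField IsDedekindDomain Field WeierstrassCurve
  Literature.NumberTheory.EllipticCurves Literature.NumberTheory.EllipticCurves.GreenbergSelmer
  Literature.NumberTheory.EllipticCurves.Rank1Residual
  Literature.NumberTheory.GaloisRepresentations
  Summit.BirchSwinnertonDyer.Rank1Residual.X11b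
  Summit.BirchSwinnertonDyer.BirchSwinnertonDyer.Theorems.SchneiderFreeAdditiveX3
  Summit.BirchSwinnertonDyer.BirchSwinnertonDyer.Theorems.LocalTowerTorsionTwoLines
  Summit.Ventures.HodgeRepro2.T5DegreeOneNumberField

set_option linter.dupNamespace false
set_option autoImplicit false

/-! ## §1. Bézout and the graded bounded-kernel clause modulo a subgroup -/

section Graded

variable {K : Type} [Field K] {p : ℕ} [hp : Fact p.Prime] {M : Type} [AddCommGroup M]
  [DistribMulAction (absoluteGaloisGroup K) M]

/-- **Bézout modulo `C`**: if `p^n (u • x) ∈ C` with `p ∤ u` and `x` of `p`-power order, then `p^n x ∈ C`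
(`1 = s u + t p^k`). [folklore] -/
theorem pow_smul_mem_of_pow_smul_zsmul_mem (C : AddSubgroup M) {u : ℤ} (hu : ¬ (p : ℤ) ∣ u) {x : M}
    (hx : ∃ k : ℕ, p ^ k • x = 0) {n : ℕ} (h : p ^ n • (u • x) ∈ C) : p ^ n • x ∈ C := by
  obtain ⟨k, hk⟩ := hx
  have hpi : Irreducible (p : ℤ) := (Nat.prime_iff_prime_int.mp hp.out).irreducible
  have hcop : IsCoprime u ((p : ℤ) ^ k) := (hpi.coprime_iff_not_dvd.mpr hu).symm.pow_right
  obtain ⟨s, t, hst⟩ := hcop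
  have hx1 : x = s • (u • x) + t • ((p : ℤ) ^ k • x) := by
    rw [smul_smul, smul_smul, ← add_smul, hst, one_smul]
  have hpk : (p : ℤ) ^ k • x = 0 := by
    rw [show ((p : ℤ) ^ k) = ((p ^ k : ℕ) : ℤ) by push_cast; rfl, natCast_zsmul, hk]
  rw [hx1, hpk, smul_zero, add_zero, smul_comm]
  exact C.zsmul_mem h s

/-- **Bounded kernel on the quotient from a graded scalar action.** `M` a `p`-primary `Γ_K`-module, `C ≤ M`, `g ∈ Γ_K` acting on
`M ⧸ C` through one `λ ∈ ℤ_p`, `λ ≠ 1`, in the graded sense: for `x` with `p^k x ∈ C` and any integer `N ≡ λ (mod p^k)`,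
`g x − N x ∈ C`. Then `p^j (g x − x) ∈ C ⟹ p^{j+e} x ∈ C` with `e = v_p(λ − 1)` (the quotient-mover clause of
`WeierstrassCurve.localTowerTorsionFiniteAt_of_stableLine_quotient`). [folklore] -/
theorem boundedKernel_mod_of_smul_congr_padicInt (C : AddSubgroup M) {g : absoluteGaloisGroup K}
    {lam : ℤ_[p]} (hlam : lam ≠ 1) (htor : ∀ m : M, ∃ k : ℕ, p ^ k • m = 0)
    (hact : ∀ (k : ℕ) (x : M), p ^ k • x ∈ C →
      ∀ N : ℤ, ((N : ℤ_[p]) - lam) ∈ (Ideal.span {(p : ℤ_[p]) ^ k} : Ideal ℤ_[p]) → g • x - N • x ∈ C) :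
    ∃ e : ℕ, ∀ x : M, ∀ j : ℕ, p ^ j • (g • x - x) ∈ C → p ^ (j + e) • x ∈ C := by
  have hpr : p.Prime := hp.out
  set t : ℤ_[p] := lam - 1 with ht
  have ht0 : t ≠ 0 := sub_ne_zero.mpr hlam
  refine ⟨t.valuation, fun x j hj ↦ ?_⟩
  set e := t.valuation with he
  obtain ⟨k, hk⟩ := htor x
  have hkC : p ^ k • x ∈ C := by rw [hk]; exact C.zero_mem
  set N : ℕ := (PadicInt.toZModPow k lam).val with hN
  have hNmem : (((N : ℤ) : ℤ_[p])) - lam ∈ (Ideal.span {(p : ℤ_[p]) ^ k} : Ideal ℤ_[p]) := by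
    rw [← PadicInt.ker_toZModPow, RingHom.mem_ker, map_sub, map_intCast, Int.cast_natCast, hN,
      ZMod.natCast_zmod_val, sub_self]
  have hgx : g • x - (N : ℤ) • x ∈ C := hact k x hkC (N : ℤ) hNmem
  -- `p^j ((N − 1) x) ∈ C`
  have hj' : p ^ j • (((N : ℤ) - 1) • x) ∈ C := by
    have h1 : ((N : ℤ) - 1) • x = (g • x - x) - (g • x - (N : ℤ) • x) := by rw [sub_smul, one_smul]; abel
    rw [h1, smul_sub]
    exact C.sub_mem hj (C.nsmul_mem hgx _)
  by_cases hkje : k ≤ j + e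
  · obtain ⟨d, hd⟩ := Nat.exists_eq_add_of_le hkje
    rw [hd, pow_add, mul_comm, mul_smul, hk, smul_zero]
    exact C.zero_mem
  · have hek : e < k := by omega
    have hN1 : (((N : ℤ) - 1 : ℤ) : ℤ_[p]) = t + ((((N : ℤ) : ℤ_[p])) - lam) := by
      push_cast; rw [ht]; ring
    obtain ⟨c, hc⟩ := Ideal.mem_span_singleton.mp hNmem
    set w : ℤ_[p] := (PadicInt.unitCoeff ht0 : ℤ_[p]) with hw
    have htu : t = w * (p : ℤ_[p]) ^ e := by rw [hw, he]; exact PadicInt.unitCoeff_spec ht0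
    have hpk : (p : ℤ_[p]) ^ k = (p : ℤ_[p]) ^ e * (p : ℤ_[p]) ^ (k - e) := by
      rw [← pow_add, Nat.add_sub_cancel' hek.le]
    have hdvd : ((p : ℤ) ^ e) ∣ (N : ℤ) - 1 := by
      rw [← PadicInt.pow_p_dvd_int_iff]
      refine ⟨w + (p : ℤ_[p]) ^ (k - e) * c, ?_⟩
      rw [Int.cast_sub, Int.cast_one] at hN1 ⊢
      rw [hN1, hc]
      linear_combination htu + c * hpk
    have hndvd : ¬ ((p : ℤ) ^ (e + 1)) ∣ (N : ℤ) - 1 := by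
      rw [← PadicInt.pow_p_dvd_int_iff]
      rintro ⟨d, hd⟩
      have htmem : t ∈ (Ideal.span {(p : ℤ_[p]) ^ (e + 1)} : Ideal ℤ_[p]) := by
        have : t = (p : ℤ_[p]) ^ (e + 1) * d - ((((N : ℤ) : ℤ_[p])) - lam) := by
          rw [Int.cast_sub, Int.cast_one] at hd hN1
          rw [← hd, hN1]; ring
        rw [this, hc]
        refine Ideal.sub_mem _ (Ideal.mem_span_singleton.mpr ⟨d, rfl⟩)
          (Ideal.mem_span_singleton.mpr ⟨(p : ℤ_[p]) ^ (k - (e + 1)) * c, ?_⟩)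
        rw [← mul_assoc, ← pow_add, Nat.add_sub_cancel' (by omega)]
      have := (PadicInt.mem_span_pow_iff_le_valuation t ht0 (e + 1)).mp htmem
      omega
    obtain ⟨u, hu⟩ := hdvd
    have hpu : ¬ (p : ℤ) ∣ u := by
      rintro ⟨u', rfl⟩
      exact hndvd ⟨u', by rw [hu, pow_succ]; ring⟩
    have hj'' : p ^ (j + e) • (u • x) ∈ C := by
      rw [hu, mul_smul, show ((p : ℤ) ^ e) = ((p ^ e : ℕ) : ℤ) by push_cast; rfl, natCast_zsmul,
        smul_smul, ← pow_add] at hj'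
      exact hj'
    exact pow_smul_mem_of_pow_smul_zsmul_mem C hpu (htor x) hj''

end Graded

/-! ## §2. The mover, packaged: the norm-residue element and its two scalars -/

section Mover

variable {K : Type} [Field K] [NumberField K]

/-- `e(𝔭|𝓞 ℚ) = e(𝔭|ℤ)`. [folklore] -/
private theorem ramificationIdx_rat_eq_int' (q : Ideal (𝓞 K)) : q.ramificationIdx (𝓞 ℚ) = q.ramificationIdx ℤ := by
  by_cases hq : q.IsPrime
  · rw [Ideal.ramificationIdx_def, Ideal.ramificationIdx_def]
    have hsurj : Function.Surjective (algebraMap ℤ (𝓞 ℚ)) := Rat.int_algebraMap_surjective (𝓞 ℚ)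
    have hφ : algebraMap ℤ (Localization.AtPrime q) =
        (algebraMap (𝓞 ℚ) (Localization.AtPrime q)).comp (algebraMap ℤ (𝓞 ℚ)) := RingHom.ext_int _ _
    have hunder : q.under ℤ = (q.under (𝓞 ℚ)).comap (algebraMap ℤ (𝓞 ℚ)) := by
      rw [Ideal.under_def, Ideal.under_def, Ideal.comap_comap, ← RingHom.ext_int
        (algebraMap ℤ (𝓞 K)) ((algebraMap (𝓞 ℚ) (𝓞 K)).comp (algebraMap ℤ (𝓞 ℚ)))]
    have hI : (q.under ℤ).map (algebraMap ℤ (Localization.AtPrime q)) =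
        (q.under (𝓞 ℚ)).map (algebraMap (𝓞 ℚ) (Localization.AtPrime q)) := by
      rw [hunder, hφ, ← Ideal.map_map, Ideal.map_comap_of_surjective _ hsurj]
    rw [hI]
  · rw [Ideal.ramificationIdx_of_not_isPrime q _ hq, Ideal.ramificationIdx_of_not_isPrime q _ hq]

/-- `f(𝔭|𝓞 ℚ) = f(𝔭|ℤ)`. [folklore] -/
private theorem inertiaDeg_rat_eq_int' (q : Ideal (𝓞 K)) [q.IsMaximal] : q.inertiaDeg (𝓞 ℚ) = q.inertiaDeg ℤ := by
  haveI hQ : (q.under (𝓞 ℚ)).IsMaximal := Ideal.IsMaximal.under (𝓞 ℚ) q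
  have h1 : (q.under (𝓞 ℚ)).inertiaDeg ℤ = 1 := by
    set Q := q.under (𝓞 ℚ)
    haveI : (Q.under ℤ).IsMaximal := Ideal.IsMaximal.under ℤ Q
    rw [← Ideal.inertiaDeg'_eq_inertiaDeg (Q.under ℤ) Q, Ideal.inertiaDeg'_algebraMap]
    letI : Field (ℤ ⧸ Q.under ℤ) := Ideal.Quotient.field _
    letI : Field (𝓞 ℚ ⧸ Q) := Ideal.Quotient.field _
    have hsurj : Function.Surjective (algebraMap (ℤ ⧸ Q.under ℤ) (𝓞 ℚ ⧸ Q)) := by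
      intro y
      obtain ⟨y, rfl⟩ := Ideal.Quotient.mk_surjective y
      obtain ⟨x, rfl⟩ := Rat.int_algebraMap_surjective (𝓞 ℚ) y
      exact ⟨Ideal.Quotient.mk _ x, rfl⟩
    have e : (ℤ ⧸ Q.under ℤ) ≃ₗ[ℤ ⧸ Q.under ℤ] (𝓞 ℚ ⧸ Q) :=
      LinearEquiv.ofBijective (Algebra.linearMap (ℤ ⧸ Q.under ℤ) (𝓞 ℚ ⧸ Q))
        ⟨(algebraMap (ℤ ⧸ Q.under ℤ) (𝓞 ℚ ⧸ Q)).injective, hsurj⟩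
    rw [← e.finrank_eq, Module.finrank_self]
  rw [Ideal.inertiaDeg_tower (R := ℤ) (q.under (𝓞 ℚ)) q, h1, one_mul]

/-- **The mover and its two scalars.** `K` imaginary quadratic, `𝔭 ∋ 2` of degree one. There is `σ₀ ∈ Γ_{K_𝔭}` of Frobenius degree
`h ≥ 1` (the anticyclotomic norm-residue element of `c(π)/π`, `𝔭^h = (π)`; p627732) with `res σ₀ ∈ ker κ` for EVERY anticyclotomic
`ℤ₂`-extension `κ`, such that for every unit `α ∈ ℤ₂` with `α² = α − 2` and every sign `s = ±1`: `s·α^h ≠ 1` (`unitRoot_pow_ne_of_sq_eq`)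
and `s·ε(res σ₀)·α^{−h} ≠ 1` (else `s α^h φ(π)² = 2^{2h}`, excluded by the weight obstruction `ne_of_unitRoot_of_span_eq_pow`).
[cite: CasselsFrohlichANT1967, Ch. VII §6 Prop. 6.2] [cite: JetchevSkinnerWan2017, §3.3 Prop. 3.3.4 Case 3(b) (arXiv:1512.06894 p. 13)] -/
theorem exists_normResidue_scalars_ne_one (hK : IsImaginaryQuadratic K) (𝔭 : HeightOneSpectrum (𝓞 K))
    (h𝔭 : ((2 : ℕ) : 𝓞 K) ∈ 𝔭.asIdeal) (he : 𝔭.asIdeal.ramificationIdx (𝓞 ℚ) = 1) (hf : 𝔭.asIdeal.inertiaDeg (𝓞 ℚ) = 1) :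
    ∃ (σ₀ : absoluteGaloisGroup (𝔭.adicCompletion K)) (h : ℕ), 0 < h ∧ IsFrobPow σ₀ (h : ℤ) ∧
      (∀ κ : ZpExtension K 2, κ.IsAnticyclotomic → absGaloisRestrict K (𝔭.adicCompletion K) σ₀ ∈ κ.kerSubgroup) ∧
      ∀ (α : ℤ_[2]ˣ), (α : ℤ_[2]) ^ 2 = (α : ℤ_[2]) - 2 → ∀ s : ℤ, (s = 1 ∨ s = -1) →
        (s : ℤ_[2]) * ((α ^ h : ℤ_[2]ˣ) : ℤ_[2]) ≠ 1 ∧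
        (s : ℤ_[2]) * ((GaloisRep.cyclotomicCharacter K 2 (absGaloisRestrict K (𝔭.adicCompletion K) σ₀) * (α⁻¹) ^ h :
          ℤ_[2]ˣ) : ℤ_[2]) ≠ 1 := by
  have hpr : (2 : ℕ).Prime := Nat.prime_two
  have h2 : Module.finrank ℚ K = 2 := hK.1
  haveI := liesOver_span_of_natCast_mem (K := K) (p := 2) h𝔭
  haveI := 𝔭.isMaximal
  have hdeg : 𝔭.asIdeal.ramificationIdx ℤ * 𝔭.asIdeal.inertiaDeg ℤ = 1 := by
    rw [← ramificationIdx_rat_eq_int', ← inertiaDeg_rat_eq_int', he, hf]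
  obtain ⟨h, π, hh, hπ⟩ := exists_pow_eq_span_singleton 𝔭
  obtain ⟨σ₀, hfrob, hker, hcyc⟩ :=
    ZpExtension.exists_isFrobPow_mem_kerSubgroup_of_isAnticyclotomic_anyPrime K 2 hK 𝔭 h𝔭 he hf h π hh hπ
  refine ⟨σ₀, h, hh, hfrob, hker, fun α hα s hs ↦ ?_⟩
  set g := absGaloisRestrict K (𝔭.adicCompletion K) σ₀ with hg
  set εu : ℤ_[2]ˣ := GaloisRep.cyclotomicCharacter K 2 g with hεu
  have hB := mul_sq_eq_of_congruences (p := 2) 𝔭 hdeg hπ hcyc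
  set φ := integersToPadicInt 𝔭 2 hdeg with hφ
  have hαQ : (((α : ℤ_[2]) : ℚ_[2])) ^ 2 = ((α : ℤ_[2]) : ℚ_[2]) - 2 := by
    have := congrArg (fun z : ℤ_[2] ↦ (z : ℚ_[2])) hα
    push_cast at this
    exact this
  have hss : (s : ℤ_[2]) * s = 1 := by rcases hs with rfl | rfl <;> push_cast <;> norm_num
  refine ⟨?_, ?_⟩
  · intro H
    have H' : ((α : ℤ_[2])) ^ h = s := by
      calc ((α : ℤ_[2])) ^ h = (s : ℤ_[2]) * s * (α : ℤ_[2]) ^ h := by rw [hss, one_mul]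
        _ = s * ((s : ℤ_[2]) * ((α ^ h : ℤ_[2]ˣ) : ℤ_[2])) := by rw [Units.val_pow_eq_pow_val]; ring
        _ = s := by rw [H, mul_one]
    have H'' : (((α : ℤ_[2]) : ℚ_[2])) ^ h = (s : ℚ_[2]) := by
      have := congrArg (fun z : ℤ_[2] ↦ (z : ℚ_[2])) H'
      simpa using this
    exact unitRoot_pow_ne_of_sq_eq (R := ℚ_[2]) (a := 1) (p := 2) (by norm_num) le_rfl
      (α := ((α : ℤ_[2]) : ℚ_[2])) (by push_cast; linear_combination hαQ) hh hs H''
  · intro H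
    have hεα : (εu : ℤ_[2]) = s * (α : ℤ_[2]) ^ h := by
      have h2' : ((α⁻¹ ^ h : ℤ_[2]ˣ) : ℤ_[2]) * (α : ℤ_[2]) ^ h = 1 := by
        rw [← Units.val_pow_eq_pow_val, ← Units.val_mul, ← mul_pow, inv_mul_cancel, one_pow, Units.val_one]
      calc (εu : ℤ_[2]) = (s * s) * (εu : ℤ_[2]) * (((α⁻¹ ^ h : ℤ_[2]ˣ) : ℤ_[2]) * (α : ℤ_[2]) ^ h) := by
              rw [hss, h2', one_mul, mul_one]
        _ = s * ((s : ℤ_[2]) * ((εu * (α⁻¹) ^ h : ℤ_[2]ˣ) : ℤ_[2])) * (α : ℤ_[2]) ^ h := by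
              rw [Units.val_mul]; ring
        _ = s * (α : ℤ_[2]) ^ h := by rw [H, mul_one]
    have hC : (s : ℤ_[2]) * (α : ℤ_[2]) ^ h * φ π ^ 2 = ((2 : ℕ) : ℤ_[2]) ^ (2 * h) := by
      rw [← hεα]; exact hB
    have hN : Ideal.absNorm 𝔭.asIdeal = 2 := by
      rw [Ideal.absNorm_apply, Submodule.cardQuot_apply, ← pow_one 𝔭.asIdeal, natCard_quot_pow' 𝔭 2 hdeg 1, pow_one]
    have hφ' : Function.Injective ((PadicInt.Coe.ringHom (p := 2)).comp φ) :=
      (Subtype.val_injective).comp (integersToPadicInt_injective 𝔭 2 hdeg)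
    refine ne_of_unitRoot_of_span_eq_pow (R := ℚ_[2]) h2 𝔭.isPrime hpr hN h𝔭 (natCast_notMem_sq 𝔭 2 hdeg) hh hπ
      ((PadicInt.Coe.ringHom (p := 2)).comp φ) hφ' (a := 1) (α := ((α : ℤ_[2]) : ℚ_[2]))
      (by push_cast; linear_combination hαQ) hs ?_
    have := congrArg (fun z : ℤ_[2] ↦ (z : ℚ_[2])) hC
    push_cast at this
    exact this

end Mover

/-! ## §3. One frame: Fin_v at `(W_K, 2, κ, 𝔭)` from the ordinary filtration with its characters -/

section Frame

variable {K : Type} [Field K] [NumberField K] (W : WeierstrassCurve ℚ) [W.IsElliptic]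

/-- **Fin_v at `2` on one frame from ONE stable line with the unit-root characters.** `W/ℚ` elliptic, `K` imaginary quadratic, `κ`
an anticyclotomic `ℤ₂`-extension, `𝔭 ∋ 2` of degree one, `E = W.baseChange K`. DATUM: `C ≤ E(K̄)[2^∞]`; `α ∈ ℤ₂ˣ` with `α² = α − 2`;
for every `σ ∈ Γ_{K_𝔭}` of Frobenius degree `n ∈ ℕ`, signs `s₁, s₂ = ±1` such that `res σ` acts on `E[2^∞] ⧸ C` as every integer
`N ≡ s₂·α^n (mod 2^k)` on the classes killed by `2^k` (`2^k x ∈ C ⟹ res σ • x − N • x ∈ C`) and on each `c ∈ C` killed by `2^k` as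
every integer `N ≡ s₁·ε(res σ)·α^{−n} (mod 2^k)`. CONCLUSION: `SchneiderFreeControlAtoms.LocalTowerTorsionFiniteAt E 2 κ 𝔭` — by
`exists_normResidue_scalars_ne_one` (the mover `σ₀` and its two scalars `≠ 1`), §1 / `boundedKernel_of_smul_congr_padicInt` (bounded
kernels on the quotient and on the line) and the filtration form `localTowerTorsionFiniteAt_of_stableLine_quotient` (p628031).
[cite: GreenbergLNM1716, §3 Lemma 3.3 (p. 87)] [cite: Greenberg1991, §2 (p. 214)] -/
theorem finLoc_two_of_ordinaryFiltration_at (hK : IsImaginaryQuadratic K) (κ : ZpExtension K 2) (hκ : κ.IsAnticyclotomic)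
    (𝔭 : HeightOneSpectrum (𝓞 K)) (h𝔭 : ((2 : ℕ) : 𝓞 K) ∈ 𝔭.asIdeal) (he : 𝔭.asIdeal.ramificationIdx (𝓞 ℚ) = 1)
    (hf : 𝔭.asIdeal.inertiaDeg (𝓞 ℚ) = 1)
    (C : AddSubgroup ((W.baseChange K).geomPrimaryTorsion 2)) (α : ℤ_[2]ˣ) (hα : (α : ℤ_[2]) ^ 2 = (α : ℤ_[2]) - 2)
    (hchar : ∀ (σ : absoluteGaloisGroup (𝔭.adicCompletion K)) (n : ℕ), IsFrobPow σ (n : ℤ) →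
      ∃ s₁ s₂ : ℤ, (s₁ = 1 ∨ s₁ = -1) ∧ (s₂ = 1 ∨ s₂ = -1) ∧
        (∀ (k : ℕ) (x : (W.baseChange K).geomPrimaryTorsion 2), 2 ^ k • x ∈ C →
          ∀ N : ℤ, ((N : ℤ_[2]) - s₂ * ((α ^ n : ℤ_[2]ˣ) : ℤ_[2])) ∈ (Ideal.span {(2 : ℤ_[2]) ^ k} : Ideal ℤ_[2]) →
            absGaloisRestrict K (𝔭.adicCompletion K) σ • x - N • x ∈ C) ∧
        (∀ (k : ℕ) (c : (W.baseChange K).geomPrimaryTorsion 2), c ∈ C → 2 ^ k • c = 0 →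
          ∀ N : ℤ, ((N : ℤ_[2]) - s₁ *
              ((GaloisRep.cyclotomicCharacter K 2 (absGaloisRestrict K (𝔭.adicCompletion K) σ) * (α⁻¹) ^ n : ℤ_[2]ˣ) :
                ℤ_[2])) ∈ (Ideal.span {(2 : ℤ_[2]) ^ k} : Ideal ℤ_[2]) →
            absGaloisRestrict K (𝔭.adicCompletion K) σ • c = N • c)) :
    SchneiderFreeControlAtoms.LocalTowerTorsionFiniteAt (W.baseChange K) 2 κ 𝔭 := by
  haveI : (W.baseChange K).IsElliptic := by rw [baseChange]; infer_instance
  obtain ⟨σ₀, h, hh, hfrob, hker, hscal⟩ := exists_normResidue_scalars_ne_one hK 𝔭 h𝔭 he hf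
  set g := absGaloisRestrict K (𝔭.adicCompletion K) σ₀ with hg
  have hgN : g ∈ decomp 𝔭 ⊓ κ.kerSubgroup := Subgroup.mem_inf.mpr ⟨⟨σ₀, rfl⟩, hker κ hκ⟩
  obtain ⟨s₁, s₂, hs₁, hs₂, hquot, hline⟩ := hchar σ₀ h hfrob
  obtain ⟨hlam₂, -⟩ := hscal α hα s₂ hs₂
  obtain ⟨-, hlam₁⟩ := hscal α hα s₁ hs₁
  have htor : ∀ m : (W.baseChange K).geomPrimaryTorsion 2, ∃ k : ℕ, 2 ^ k • m = 0 := fun x ↦ by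
    obtain ⟨k, hk⟩ := x.2
    exact ⟨k, Subtype.ext (by rw [AddSubgroupClass.coe_nsmul, hk]; rfl)⟩
  obtain ⟨e₁, he₁⟩ := boundedKernel_mod_of_smul_congr_padicInt (K := K) C (g := g) hlam₂ htor
    (fun k x hx N hN ↦ hquot k x hx N hN)
  obtain ⟨e₂, he₂⟩ := boundedKernel_of_smul_congr_padicInt (K := K) C (g := g) hlam₁ htor
    (fun k c hc hk N hN ↦ hline k c hc hk N hN)
  exact (W.baseChange K).localTowerTorsionFiniteAt_of_stableLine_quotient κ 𝔭 C ⟨g, hgN, e₁, he₁⟩ ⟨g, hgN, e₂, he₂⟩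

end Frame

/-! ## §4. The registered stub from the ∀-form of the ordinary-filtration datum over the class -/

/-- **`stub_finLoc_two` modulo the ordinary filtration at `2`** — the registered signature of the stub (crux 20368, line
`eisenstein_two_bdp_line` v9.1) VERBATIM as conclusion, from ONE displayed hypothesis `hFilt`: for every `W` in the class, every
imaginary quadratic `K` and every degree-one `𝔭 ∣ 2`, a subgroup `C ≤ E[2^∞]` (`E = W.baseChange K`; intended: the `2^∞`-torsion of
the kernel of reduction of the good ordinary twist, transported to `W`), the unit root `α` of `X² − X + 2`, and for every element of
`Γ_{K_𝔭}` of Frobenius degree `n` the quotient character `s₂·α^n` on `E[2^∞] ⧸ C` and the line character `s₁·ε·α^{−n}` on `C`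
(graded, signs `±1`). This is Greenberg's ordinary filtration WITH the unit-root Frobenius eigenvalue (Greenberg 1991 §2 / LNM 1716
§2; Serre 1972 §1.11; Mazur 1972), cite-level and CM-free — the text a lead can register as `stub_ordinaryFiltrationAtTwo`, with
`stub_finLoc_two := finLoc_two_of_ordinaryFiltration stub_ordinaryFiltrationAtTwo`. CONDITIONAL on `hFilt`; closes nothing by itself.
[cite: Greenberg1991, §2 (p. 214)] [cite: GreenbergLNM1716, §2 pp. 62–63 and §3 Lemma 3.3] -/
theorem finLoc_two_of_ordinaryFiltration
    (hFilt : ∀ (W : WeierstrassCurve ℚ) [W.IsElliptic] [W.IsGloballyMinimal],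
      W.HasCM → W.analyticRank = 1 → CMSplit W 2 → ¬ Good W 2 →
      ∀ (K : Type) [Field K] [NumberField K], IsImaginaryQuadratic K →
        ∀ (𝔭 : HeightOneSpectrum (𝓞 K)), ((2 : ℕ) : 𝓞 K) ∈ 𝔭.asIdeal → 𝔭.asIdeal.ramificationIdx (𝓞 ℚ) = 1 →
          𝔭.asIdeal.inertiaDeg (𝓞 ℚ) = 1 →
          ∃ (C : AddSubgroup ((W.baseChange K).geomPrimaryTorsion 2)) (α : ℤ_[2]ˣ),
            (α : ℤ_[2]) ^ 2 = (α : ℤ_[2]) - 2 ∧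
            ∀ (σ : absoluteGaloisGroup (𝔭.adicCompletion K)) (n : ℕ), IsFrobPow σ (n : ℤ) →
              ∃ s₁ s₂ : ℤ, (s₁ = 1 ∨ s₁ = -1) ∧ (s₂ = 1 ∨ s₂ = -1) ∧
                (∀ (k : ℕ) (x : (W.baseChange K).geomPrimaryTorsion 2), 2 ^ k • x ∈ C →
                  ∀ N : ℤ, ((N : ℤ_[2]) - s₂ * ((α ^ n : ℤ_[2]ˣ) : ℤ_[2])) ∈
                      (Ideal.span {(2 : ℤ_[2]) ^ k} : Ideal ℤ_[2]) →
                    absGaloisRestrict K (𝔭.adicCompletion K) σ • x - N • x ∈ C) ∧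
                (∀ (k : ℕ) (c : (W.baseChange K).geomPrimaryTorsion 2), c ∈ C → 2 ^ k • c = 0 →
                  ∀ N : ℤ, ((N : ℤ_[2]) - s₁ *
                      ((GaloisRep.cyclotomicCharacter K 2 (absGaloisRestrict K (𝔭.adicCompletion K) σ) * (α⁻¹) ^ n :
                        ℤ_[2]ˣ) : ℤ_[2])) ∈ (Ideal.span {(2 : ℤ_[2]) ^ k} : Ideal ℤ_[2]) →
                    absGaloisRestrict K (𝔭.adicCompletion K) σ • c = N • c)) :
    ∀ (W : WeierstrassCurve ℚ) [W.IsElliptic] [W.IsGloballyMinimal],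
      W.HasCM → W.analyticRank = 1 → CMSplit W 2 → ¬ Good W 2 →
      ∀ (K : Type) [Field K] [NumberField K], IsImaginaryQuadratic K →
        ∀ (κ : ZpExtension K 2), κ.IsAnticyclotomic →
          ∀ (𝔭 : HeightOneSpectrum (𝓞 K)), ((2 : ℕ) : 𝓞 K) ∈ 𝔭.asIdeal → 𝔭.asIdeal.ramificationIdx (𝓞 ℚ) = 1 →
            𝔭.asIdeal.inertiaDeg (𝓞 ℚ) = 1 →
            SchneiderFreeControlAtoms.LocalTowerTorsionFiniteAt (W.baseChange K) 2 κ 𝔭 := by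
  intro W _ _ hCM hr hsp hng K _ _ hK κ hκ 𝔭 h𝔭 he hf
  obtain ⟨C, α, hα, hchar⟩ := hFilt W hCM hr hsp hng K hK 𝔭 h𝔭 he hf
  exact finLoc_two_of_ordinaryFiltration_at W hK κ hκ 𝔭 h𝔭 he hf C α hα hchar

end Summit.BirchSwinnertonDyer.BirchSwinnertonDyer.Theorems.PrintCf2.EisensteinTwo

end
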